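import Summits.Langlands.Langlands.Theorems.IrreducibleOffSector.Negative.FalseWithoutPos

/-!
# Guards of isobaric rigidity (stub `stub_isobaricRigidity` = K1 of line `Sketch`, crux
stmt-Langlands-14329 `IrreducibleOffSector`, route `IrreducibilityBySelfDuality`) — negative side

The lead's stub K1 (k-ary Jacquet–Shalika rigidity, Jacquet–Shalika 1981 II, Thm. 4.4) reads, after
its three printed antecedents: for `K`, `0 < n`, a cuspidal `π` on `GL_n(𝔸_K)`, `k ≥ 2` cuspidal
blocks `σ_i` on `GL_{m_i}(𝔸_K)` with `0 < m_i`, it is NOT the case that at almost every place every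
Satake parameter of `π` is a sum `Σ_i β_i` of Satake parameters of the blocks. This file records,
sorry-free:

* `isobaricRigidity_false_without_blockPos` — the block guard `∀ i, 0 < m i` is load-bearing: the
  junk cuspidal `GL_0` datum of `Negative.FalseWithoutPos` (Satake parameter `∅` at every place)
  pads any decomposition, `t_π = ∅ + t_π` (witness `K = ℚ`, `n = 1`, `k = 2`, ranks `(0, 1)`);
* `isobaricRigidity_false_without_two_le` — `2 ≤ k` is load-bearing (one block: `π` itself);
* `isobaricRigidity_of_card_ne` — the TRUE complement, free of any L-function input: if
  `Σ m_i ≠ n` the eventual decomposition fails for every datum `π` (a.e. unramified, Flath 1979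
  Thm. 3, `hasSatakeParamAt_cofinite_holds`; `card = rank`; infinitely many places), so K1 reduces
  at once to `Σ m_i = n`, the genuine Jacquet–Shalika case.

No stub is refuted; no proposition is defined under `Summits/`. Rank-one inhabitant: the trivial
character datum `ℂ·1/⊥` of `GL_1` (`exists_trivialCuspidalOne`), from the constant automorphic form
of `Negative.FalseWithoutPos`.

References: H. Jacquet, J. Shalika, *On Euler products and the classification of automorphic
forms II*, Amer. J. Math. 103 (1981), Thm. 4.4; D. Flath, *Decomposition of representations into
tensor products*, Corvallis 1979, Thm. 3.
-/

noncomputable section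

-- `Summit.Langlands.Langlands.…` (summit = sub-problem name, D-0017 layout) trips `dupNamespace`.
set_option linter.dupNamespace false

open scoped NumberField Classical
open Filter IsDedekindDomain
open Literature.NumberTheory.Automorphic Literature.NumberTheory.GaloisRepresentations
open Summit.Langlands

namespace Summit.Langlands.Langlands.Theorems.IrreducibleOffSector.Negative

/-! ### A rank-one cuspidal datum (the trivial character) -/

/-- **The trivial datum `ℂ · 1 / ⊥` of `GL_1(𝔸_K)` is cuspidal** (in rank `1` the cusp
conditions `0 < k < 1` are empty as well); in particular `CuspidalAutomorphicRepData 1 K hcpt` is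
inhabited. Borel–Jacquet 1979, 4.6 (`GL(1)`). [folklore] -/
theorem exists_trivialCuspidalOne {K : Type} [Field K] [NumberField K]
    (hcpt : isCompact_glFiniteIntegralLevel 1 K) :
    ∃ π : CuspidalAutomorphicRepData 1 K hcpt,
      π.1.W = Submodule.span ℂ {fun _ : (AdelicGroupData.gl 1 K).Adelic => (1 : ℂ)} ∧
        π.1.W' = ⊥ := by
  obtain ⟨π, hW, hW'⟩ := exists_trivialRepData hcpt
  refine ⟨⟨π, ?_⟩, hW, hW'⟩
  rw [hW]
  exact Submodule.span_le.2 (by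
    rintro _ rfl
    exact Submodule.subset_span
      ⟨isAutomorphicForm_constOne hcpt, fun k hk hk1 => absurd hk1 (by omega)⟩)

/-! ### The guards of isobaric rigidity (stub `stub_isobaricRigidity` of line `Sketch`) -/

/-- **Isobaric rigidity is false without the block guard `∀ i, 0 < m i`.** The proposition
negated is the CONSEQUENT of the line's stub `stub_isobaricRigidity` (k-ary Jacquet–Shalika
rigidity: a cuspidal `π` on `GL_n`, `0 < n`, is not almost everywhere the isobaric sum of
`k ≥ 2` cuspidal blocks) with the guard `(∀ i, 0 < m i) →` deleted, everything else verbatim.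
Witness: `K = ℚ`, `n = 1`, `π` the trivial character datum, `k = 2`, blocks of ranks
`m = (0, 1)`: the junk `GL_0` block (`exists_trivialCuspidalZero`, Satake parameter `∅` at every
place) and `π` itself; then `t_{π,v} = ∅ + t_{π,v}` at EVERY place, so the decomposition holds
eventually (indeed always). Moral for the lead: the guard `0 < m i` is load-bearing in K1 exactly
as `0 < n` is in the crux (`irreducibleOffSector_false_without_pos`); with the three
Jacquet–Shalika inputs as antecedents the unguarded stub could only hold if those inputs were
inconsistent. [folklore] -/
theorem isobaricRigidity_false_without_blockPos :
    ¬ (∀ (K : Type) [Field K] [NumberField K] (n : ℕ)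
        (hcpt : isCompact_glFiniteIntegralLevel n K), 0 < n →
        ∀ (π : CuspidalAutomorphicRepData n K hcpt) (k : ℕ) (m : Fin k → ℕ)
          (hm : ∀ i, isCompact_glFiniteIntegralLevel (m i) K)
          (σ : ∀ i, CuspidalAutomorphicRepData (m i) K (hm i)), 2 ≤ k →
          ¬ ∀ᶠ v : HeightOneSpectrum (𝓞 K) in cofinite, ∀ α : Multiset ℂ,
              π.1.HasSatakeParamAt v α →
                ∃ β : Fin k → Multiset ℂ, (∀ i, (σ i).1.HasSatakeParamAt v (β i)) ∧
                  α = ∑ i, β i) := by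
  intro h
  have hc : ∀ j, isCompact_glFiniteIntegralLevel j ℚ := fun j => isCompact_glFiniteIntegralLevel_holds j ℚ
  obtain ⟨π₀, hW₀, hW₀'⟩ := exists_trivialCuspidalZero (hc 0)
  obtain ⟨π₁, -, -⟩ := exists_trivialCuspidalOne (hc 1)
  let m : Fin 2 → ℕ := fun i => (i : ℕ)
  let σ : ∀ i : Fin 2, CuspidalAutomorphicRepData (m i) ℚ (hc (m i)) :=
    Fin.cons π₀ (Fin.cons π₁ finZeroElim)
  refine h ℚ 1 (hc 1) one_pos π₁ 2 m (fun i => hc (m i)) σ le_rfl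
    (Filter.Eventually.of_forall fun v α hα => ⟨![∅, α], ?_, by simp⟩)
  refine Fin.forall_fin_two.2 ⟨?_, ?_⟩
  · exact hasSatakeParamAt_empty_of_W_eq (hc 0) π₀.1 hW₀ hW₀' v
  · exact hα

/-- **Isobaric rigidity is false without `2 ≤ k`.** The proposition negated is the consequent
of `stub_isobaricRigidity` with `2 ≤ k →` deleted, everything else verbatim. Witness: `K = ℚ`,
`n = 1`, `π` the trivial character datum, `k = 1`, the single block `π` itself (`β = t_{π,v}`):
a one-block "decomposition" is an identity. (Trivial, recorded so that no seat weakens the guard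
to `1 ≤ k`.) [folklore] -/
theorem isobaricRigidity_false_without_two_le :
    ¬ (∀ (K : Type) [Field K] [NumberField K] (n : ℕ)
        (hcpt : isCompact_glFiniteIntegralLevel n K), 0 < n →
        ∀ (π : CuspidalAutomorphicRepData n K hcpt) (k : ℕ) (m : Fin k → ℕ)
          (hm : ∀ i, isCompact_glFiniteIntegralLevel (m i) K)
          (σ : ∀ i, CuspidalAutomorphicRepData (m i) K (hm i)), (∀ i, 0 < m i) →
          ¬ ∀ᶠ v : HeightOneSpectrum (𝓞 K) in cofinite, ∀ α : Multiset ℂ,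
              π.1.HasSatakeParamAt v α →
                ∃ β : Fin k → Multiset ℂ, (∀ i, (σ i).1.HasSatakeParamAt v (β i)) ∧
                  α = ∑ i, β i) := by
  intro h
  have hc : isCompact_glFiniteIntegralLevel 1 ℚ := isCompact_glFiniteIntegralLevel_holds 1 ℚ
  obtain ⟨π₁, -, -⟩ := exists_trivialCuspidalOne hc
  exact h ℚ 1 hc one_pos π₁ 1 (fun _ => 1) (fun _ => hc) (fun _ => π₁) (fun _ => one_pos)
    (Filter.Eventually.of_forall fun v α hα => ⟨fun _ => α, fun _ => hα, by simp⟩)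

/-! ### The true complement: the cardinality case of K1 (no Jacquet–Shalika input needed) -/

/-- **K1, cardinality case** (the part of `stub_isobaricRigidity` that the guards do not touch
and that needs no L-function input): if `Σ m_i ≠ n`, NO datum `π` on `GL_n` — cuspidal or not,
any `n` — is almost everywhere the sum of Satake parameters of blocks of ranks `m_i`, because `π`
is unramified at all but finitely many of the infinitely many finite places
(`hasSatakeParamAt_cofinite_holds`, `infinite_heightOneSpectrum`) and Satake parameters have
`card = rank` (`HasSatakeParamAt.card_eq`, `Multiset.card_sum`). So the lead's K1 proof may
reduce at once to `Σ m_i = n`, where the Jacquet–Shalika pole/non-vanishing argument lives.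
Flath 1979, Thm. 3 (a.e. unramified). [folklore] -/
theorem isobaricRigidity_of_card_ne {K : Type} [Field K] [NumberField K] {n : ℕ}
    {hcpt : isCompact_glFiniteIntegralLevel n K} (π : CuspidalAutomorphicRepData n K hcpt)
    {k : ℕ} {m : Fin k → ℕ} {hm : ∀ i, isCompact_glFiniteIntegralLevel (m i) K}
    (σ : ∀ i, CuspidalAutomorphicRepData (m i) K (hm i)) (hne : ∑ i, m i ≠ n) :
    ¬ ∀ᶠ v : HeightOneSpectrum (𝓞 K) in cofinite, ∀ α : Multiset ℂ, π.1.HasSatakeParamAt v α →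
        ∃ β : Fin k → Multiset ℂ, (∀ i, (σ i).1.HasSatakeParamAt v (β i)) ∧ α = ∑ i, β i := by
  intro h
  haveI : Infinite (HeightOneSpectrum (𝓞 K)) := infinite_heightOneSpectrum K
  obtain ⟨v, ⟨α, hα⟩, hv⟩ :=
    ((AutomorphicRepData.hasSatakeParamAt_cofinite_holds π.1).and h).exists
  obtain ⟨β, hβ, rfl⟩ := hv α hα
  apply hne
  have hcard := hα.card_eq
  rw [Multiset.card_sum] at hcard
  rw [← hcard]
  exact Finset.sum_congr rfl fun i _ => ((hβ i).card_eq).symm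

end Summit.Langlands.Langlands.Theorems.IrreducibleOffSector.Negative

end
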